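import Summits.MatrixMultiplication.OmegaCensus.DicyclicLaw128
import Summits.MatrixMultiplication.OmegaCensus.DicyclicLaw32Z4Z4Reduction
import Summits.MatrixMultiplication.OmegaCensus.VertexCountingGap16
import HarnessLib

/-!
# The dicyclic law at `|A| = 32`: not attained whenever `A/⟨c₀⟩ ↠ ℤ₄ × ℤ₄`

ω-census `pub-omega`, family (b3), seat pub-omega-group gen 15.  Framing: lottery ticket; floor = certified bounds/negative
ranges.  VALUE: kernel theorems about the group-theoretic method (TPP capacity of dihedral-like groups); NOT progress on ω.

**Theorem (`no_dicyclic_law_card_32_of_onto_z4z4`).** Let `G(A, c₀)` be of dicyclic type (`c₀ ≠ 0`), `|A| = 32`, and let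
`Φ : A →+ ZMod 4 × ZMod 4` be onto with `Φ c₀ = 0` (so `A/⟨c₀⟩ ≅ ℤ₄²`).  Then no TPP triple of `G` attains the dicyclic law
`3|S||T||U| + 16 = 8|A| = 256` (volume `80`).

Instances: `z4_z8_dicyclic_no_law_0_4` (`G(ℤ₄×ℤ₈,(0,4))`, census row NR117) and `z2_z4_z4_dicyclic_no_law_1_0_0`
(`G(ℤ₂×ℤ₄²,(1,0,0))`, NR118) — the two order-`64` dicyclic-type groups with quotient `ℤ₄²`, engine rows ×2 so far, now
kernel: `β < 80`.

*Proof.*  Gen 14's `DicyclicLaw128Classes.lean` / `DicyclicLaw128.lean` at `|A| = 32`: the class theorems N2, N3, B draw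
their conclusion from `no_dicyclic_law_of_stable_member_32` (`DicyclicLaw32Z4Z4Reduction.lean`; the `a = c₀` descent lands in
`Dih(ℤ₄²)`, `|ℤ₄²| = 16 = 3·5 + 1`), N1 is gen 14's order-free `no_n1_dicyclic_law_z4z4`, P1 is
`no_dicyclic_law_of_two_domino_32`; the shape classification (two balanced pairs) is `two_balanced_of_vertex_bounds16`
(`VertexCountingGap16.lean`: slack `16`, `V = 80 ≥ 31`) in place of `two_balanced_of_vertex_bounds31` (`V ≥ 127`).
-/

namespace Summit.MatrixMultiplication.OmegaCensus

open Literature.Combinatorics.Additive Finset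

section Classes

variable {A : Type} [AddCommGroup A] [DecidableEq A] [Fintype A] {G : Type} [Group G] [DecidableEq G]
  {ρ τ : A → G} {c₀ : A} {B : Type} [AddCommGroup B] [DecidableEq B] [Fintype B]


/-- **Class N2 at `|A| = 32`** (`(1,1 | a,a+1 | 4,4)`): `U` is `ρ(c₀)`-stable (`n2_parts_periodic_aux`), then
`no_dicyclic_law_of_stable_member_32`. [folklore] -/
theorem no_n2_dicyclic_law_32
    (hρρ : ∀ a b, ρ a * ρ b = ρ (a + b)) (hρτ : ∀ a b, ρ a * τ b = τ (b - a))
    (hτρ : ∀ a b, τ a * ρ b = τ (a + b)) (hττ : ∀ a b, τ a * τ b = ρ (c₀ + b - a)) (hc₀ : c₀ ≠ 0)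
    (hρ : Function.Injective ρ) (hτ : Function.Injective τ) (hne : ∀ a b, ρ a ≠ τ b)
    (hsurj : ∀ g, (∃ a, ρ a = g) ∨ (∃ a, τ a = g)) (hA : Fintype.card A = 32)
    (Φ : A →+ ZMod 4 × ZMod 4) (hΦ : Function.Surjective Φ) (hΦc : Φ c₀ = 0)
    (π : A →+ B) (hker : ∀ a : A, π a = 0 ↔ a = 0 ∨ a = c₀) {m : ℕ} (hB : ∀ b : B, (2 ^ m) • b = 0)
    {S T U : Finset G} (h : TripleProductProperty S T U)
    (hs₀ : (univ.filter fun a : A => ρ a ∈ S).card = 1) (hs₁ : (univ.filter fun a : A => τ a ∈ S).card = 1)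
    (hu₀ : (univ.filter fun a : A => ρ a ∈ U).card = 4) (hu₁ : (univ.filter fun a : A => τ a ∈ U).card = 4) :
    3 * (S.card * T.card * U.card) + 16 ≠ 8 * Fintype.card A := by
  intro hV
  have cS : S.card = 2 := by rw [card_eq_parts' hρ hτ hne hsurj S, hs₀, hs₁]
  have cU : U.card = 8 := by rw [card_eq_parts' hρ hτ hne hsurj U, hu₀, hu₁]
  have cT := card_eq_parts' hρ hτ hne hsurj T
  obtain ⟨h000, h111, -⟩ := vertex_counting' hρρ hρτ hτρ hττ hρ hτ hne h
  rw [hs₀, hs₁, hu₀, hu₁] at h000 h111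
  rw [cS, cT, cU] at hV
  set t₀ := (univ.filter fun a : A => ρ a ∈ T).card with ht₀
  set t₁ := (univ.filter fun a : A => τ a ∈ T).card with ht₁
  have h2c := two_c0_eq_zero hρτ hτρ hττ hτ
  have key : (univ.filter fun a : A => ρ a ∈ U).image (· + c₀) = (univ.filter fun a : A => ρ a ∈ U) ∧
      (univ.filter fun a : A => τ a ∈ U).image (· + c₀) = (univ.filter fun a : A => τ a ∈ U) := by
    by_cases hcase : t₁ = t₀ + 1
    · have hodd : Odd t₁ := ⟨t₀ / 2, by omega⟩
      exact n2_parts_periodic_aux hρρ hρτ hτρ hττ hc₀ hρ hτ hne π hker hB h hs₀ hs₁ hodd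
        (by rw [hu₀, hu₁]; omega)
    · have hcase' : t₀ = t₁ + 1 := by omega
      have er : (Equiv.mulRight (1 : G)).toEmbedding = Function.Embedding.refl G := by ext x; simp
      have h' : TripleProductProperty S (T.map (Equiv.mulRight (τ 0)).toEmbedding) U := by
        have := h.map_mulRight 1 (τ 0) 1; simpa only [er, Finset.map_refl] using this
      have cT'₀ := card_rho_part_mulRight_tau hρρ hρτ hττ (A := A) T
      have cT'₁ := card_tau_part_mulRight_tau hρρ hττ (A := A) T
      have hodd : Odd (univ.filter fun a : A => τ a ∈ T.map (Equiv.mulRight (τ 0)).toEmbedding).card := by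
        rw [cT'₁]; exact ⟨t₁ / 2, by omega⟩
      exact n2_parts_periodic_aux hρρ hρτ hτρ hττ hc₀ hρ hτ hne π hker hB h' hs₀ hs₁ hodd
        (by rw [cT'₀, cT'₁, hu₀, hu₁]; omega)
  obtain ⟨hU₀, hU₁⟩ := key
  have hstab : ∀ x ∈ U, x * ρ c₀ ∈ U := stable_of_parts_periodic hρρ hτρ hsurj hU₀ hU₁
  have hV' : 3 * (S.card * T.card * U.card) + 16 = 8 * Fintype.card A := by rw [cS, cT, cU]; exact hV
  exact no_dicyclic_law_of_stable_member_32 hρρ hρτ hτρ hττ hc₀ hρ hτ hne hsurj hA Φ hΦ hΦc h h2c hc₀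
    (Or.inr (Or.inr hstab)) hV'

/-- **Class N3 at `|A| = 32`** (`(2,2 | 2,2 | u,u+1)`): `S` or `T` is stable under a central involution
(`n3_stable_member_aux`), then `no_dicyclic_law_of_stable_member_32`. [folklore] -/
theorem no_n3_dicyclic_law_32
    (hρρ : ∀ a b, ρ a * ρ b = ρ (a + b)) (hρτ : ∀ a b, ρ a * τ b = τ (b - a))
    (hτρ : ∀ a b, τ a * ρ b = τ (a + b)) (hττ : ∀ a b, τ a * τ b = ρ (c₀ + b - a)) (hc₀ : c₀ ≠ 0)
    (hρ : Function.Injective ρ) (hτ : Function.Injective τ) (hne : ∀ a b, ρ a ≠ τ b)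
    (hsurj : ∀ g, (∃ a, ρ a = g) ∨ (∃ a, τ a = g)) (hA : Fintype.card A = 32)
    (Φ : A →+ ZMod 4 × ZMod 4) (hΦ : Function.Surjective Φ) (hΦc : Φ c₀ = 0)
    (π : A →+ B) (hker : ∀ a : A, π a = 0 ↔ a = 0 ∨ a = c₀) {m : ℕ} (hB : ∀ b : B, (2 ^ m) • b = 0)
    {S T U : Finset G} (h : TripleProductProperty S T U)
    (hs₀ : (univ.filter fun a : A => ρ a ∈ S).card = 2) (hs₁ : (univ.filter fun a : A => τ a ∈ S).card = 2)
    (ht₀ : (univ.filter fun a : A => ρ a ∈ T).card = 2) (ht₁ : (univ.filter fun a : A => τ a ∈ T).card = 2) :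
    3 * (S.card * T.card * U.card) + 16 ≠ 8 * Fintype.card A := by
  intro hV
  have cS : S.card = 4 := by rw [card_eq_parts' hρ hτ hne hsurj S, hs₀, hs₁]
  have cT : T.card = 4 := by rw [card_eq_parts' hρ hτ hne hsurj T, ht₀, ht₁]
  have cU := card_eq_parts' hρ hτ hne hsurj U
  obtain ⟨-, -, h000, h111⟩ := parts_counting' hρρ hρτ hτρ hττ hρ hτ hne h
  rw [hs₀, hs₁, ht₀, ht₁] at h000 h111
  rw [cS, cT, cU] at hV
  set u₀ := (univ.filter fun a : A => ρ a ∈ U).card with hu₀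
  set u₁ := (univ.filter fun a : A => τ a ∈ U).card with hu₁
  have key : ∃ a : A, a + a = 0 ∧ a ≠ 0 ∧ ((∀ x ∈ S, x * ρ a ∈ S) ∨ (∀ x ∈ T, x * ρ a ∈ T)) := by
    by_cases hcase : u₁ = u₀ + 1
    · have hodd : Odd u₁ := ⟨u₀ / 2, by omega⟩
      exact n3_stable_member_aux hρρ hρτ hτρ hττ hc₀ hρ hτ hne hsurj π hker hB h hs₀ hs₁ ht₀ ht₁ hodd (by omega)
    · have hcase' : u₀ = u₁ + 1 := by omega
      have er : (Equiv.mulRight (1 : G)).toEmbedding = Function.Embedding.refl G := by ext x; simp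
      have h' : TripleProductProperty S T (U.map (Equiv.mulRight (τ 0)).toEmbedding) := by
        have := h.map_mulRight 1 1 (τ 0); simpa only [er, Finset.map_refl] using this
      have cU'₀ := card_rho_part_mulRight_tau hρρ hρτ hττ (A := A) U
      have cU'₁ := card_tau_part_mulRight_tau hρρ hττ (A := A) U
      have hodd : Odd (univ.filter fun a : A => τ a ∈ U.map (Equiv.mulRight (τ 0)).toEmbedding).card := by
        rw [cU'₁]; exact ⟨u₁ / 2, by omega⟩
      exact n3_stable_member_aux hρρ hρτ hτρ hττ hc₀ hρ hτ hne hsurj π hker hB h' hs₀ hs₁ ht₀ ht₁ hodd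
        (by rw [cU'₀, cU'₁]; omega)
  obtain ⟨a, ha2, ha0, hstab⟩ := key
  have hstab' : (∀ x ∈ S, x * ρ a ∈ S) ∨ (∀ x ∈ T, x * ρ a ∈ T) ∨ (∀ x ∈ U, x * ρ a ∈ U) := by
    rcases hstab with hs | ht
    · exact Or.inl hs
    · exact Or.inr (Or.inl ht)
  have hV' : 3 * (S.card * T.card * U.card) + 16 = 8 * Fintype.card A := by rw [cS, cT, cU]; exact hV
  exact no_dicyclic_law_of_stable_member_32 hρρ hρτ hτρ hττ hc₀ hρ hτ hne hsurj hA Φ hΦ hΦc h ha2 ha0 hstab' hV'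

/-- **Class B at `|A| = 32`** (`(s,s | t,t | u,u)`): the even member is `ρ(c₀)`-stable (`classB_parts_periodic`), then
`no_dicyclic_law_of_stable_member_32`. [folklore] -/
theorem no_classB_dicyclic_law_32
    (hρρ : ∀ a b, ρ a * ρ b = ρ (a + b)) (hρτ : ∀ a b, ρ a * τ b = τ (b - a))
    (hτρ : ∀ a b, τ a * ρ b = τ (a + b)) (hττ : ∀ a b, τ a * τ b = ρ (c₀ + b - a)) (hc₀ : c₀ ≠ 0)
    (hρ : Function.Injective ρ) (hτ : Function.Injective τ) (hne : ∀ a b, ρ a ≠ τ b)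
    (hsurj : ∀ g, (∃ a, ρ a = g) ∨ (∃ a, τ a = g)) (hA : Fintype.card A = 32)
    (Φ : A →+ ZMod 4 × ZMod 4) (hΦ : Function.Surjective Φ) (hΦc : Φ c₀ = 0)
    (π : A →+ B) (hker : ∀ a : A, π a = 0 ↔ a = 0 ∨ a = c₀) {m : ℕ} (hB : ∀ b : B, (2 ^ m) • b = 0)
    {S T U : Finset G} (h : TripleProductProperty S T U)
    (hs : (univ.filter fun a : A => ρ a ∈ S).card = (univ.filter fun a : A => τ a ∈ S).card)
    (ht : (univ.filter fun a : A => ρ a ∈ T).card = (univ.filter fun a : A => τ a ∈ T).card)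
    (hu : (univ.filter fun a : A => ρ a ∈ U).card = (univ.filter fun a : A => τ a ∈ U).card) :
    3 * (S.card * T.card * U.card) + 16 ≠ 8 * Fintype.card A := by
  intro hV
  have h2c := two_c0_eq_zero hρτ hτρ hττ hτ
  set s := (univ.filter fun a : A => ρ a ∈ S).card with hsd
  set t := (univ.filter fun a : A => ρ a ∈ T).card with htd
  set u := (univ.filter fun a : A => ρ a ∈ U).card with hud
  have cS : S.card = s + s := by rw [card_eq_parts' hρ hτ hne hsurj S, ← hs]
  have cT : T.card = t + t := by rw [card_eq_parts' hρ hτ hne hsurj T, ← ht]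
  have cU : U.card = u + u := by rw [card_eq_parts' hρ hτ hne hsurj U, ← hu]
  have hV' := hV
  rw [cS, cT, cU, show (s + s) * (t + t) * (u + u) = 8 * (s * t * u) by ring] at hV'
  have hN : Fintype.card A = 3 * (s * t * u) + 2 := by omega
  have hP : s * t * u % 8 = 2 := by omega
  have key : ∃ a : A, a + a = 0 ∧ a ≠ 0 ∧
      ((∀ x ∈ S, x * ρ a ∈ S) ∨ (∀ x ∈ T, x * ρ a ∈ T) ∨ (∀ x ∈ U, x * ρ a ∈ U)) := by
    refine ⟨c₀, h2c, hc₀, ?_⟩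
    rcases Nat.even_or_odd s with hse | hso <;> rcases Nat.even_or_odd t with hte | hto <;>
      rcases Nat.even_or_odd u with hue | huo
    · exfalso; obtain ⟨a, ha⟩ := hse; obtain ⟨b, hb⟩ := hte
      rw [ha, hb, show (a + a) * (b + b) * u = 4 * (a * b * u) by ring] at hP; omega
    · exfalso; obtain ⟨a, ha⟩ := hse; obtain ⟨b, hb⟩ := hte
      rw [ha, hb, show (a + a) * (b + b) * u = 4 * (a * b * u) by ring] at hP; omega
    · exfalso; obtain ⟨a, ha⟩ := hse; obtain ⟨b, hb⟩ := hue
      rw [ha, hb, show (a + a) * t * (b + b) = 4 * (a * t * b) by ring] at hP; omega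
    · left
      obtain ⟨p₀, p₁⟩ := classB_parts_periodic hρρ hρτ hτρ hττ hc₀ hρ hτ hne π hker hB h.rotate htd.symm ht.symm
        hud.symm hu.symm hsd.symm hs.symm hto huo hse
        (by rw [hN, show t * u * s = s * t * u by ring])
      exact stable_of_parts_periodic hρρ hτρ hsurj p₀ p₁
    · exfalso; obtain ⟨a, ha⟩ := hte; obtain ⟨b, hb⟩ := hue
      rw [ha, hb, show s * (a + a) * (b + b) = 4 * (s * a * b) by ring] at hP; omega
    · right; left
      obtain ⟨p₀, p₁⟩ := classB_parts_periodic hρρ hρτ hτρ hττ hc₀ hρ hτ hne π hker hB h.rotate.rotate hud.symm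
        hu.symm hsd.symm hs.symm htd.symm ht.symm huo hso hte
        (by rw [hN, show u * s * t = s * t * u by ring])
      exact stable_of_parts_periodic hρρ hτρ hsurj p₀ p₁
    · right; right
      obtain ⟨p₀, p₁⟩ := classB_parts_periodic hρρ hρτ hτρ hττ hc₀ hρ hτ hne π hker hB h hsd.symm hs.symm
        htd.symm ht.symm hud.symm hu.symm hso hto hue (by rw [hN])
      exact stable_of_parts_periodic hρρ hτρ hsurj p₀ p₁
    · exfalso
      have hodd : Odd (s * t * u) := (hso.mul hto).mul huo
      obtain ⟨r, hr⟩ := hodd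
      omega
  obtain ⟨a, ha2, ha0, hstab⟩ := key
  exact no_dicyclic_law_of_stable_member_32 hρρ hρτ hτρ hττ hc₀ hρ hτ hne hsurj hA Φ hΦ hΦc h ha2 ha0 hstab hV

end Classes

/-! ## Assembly -/

section Assembly

variable {A : Type} [AddCommGroup A] [DecidableEq A] [Fintype A] {G : Type} [Group G] [DecidableEq G]
  {ρ τ : A → G} {c₀ : A} {B : Type} [AddCommGroup B] [DecidableEq B] [Fintype B]

/-- Two balanced members (`|S₀| = |S₁|`, `|T₀| = |T₁|`), `|A| = 32`, `A/⟨c₀⟩ ↠ ℤ₄²`: no dicyclic law (classes P1, B, N1,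
N2, N3 as in `no_dicyclic_law_of_two_balanced`). [folklore] -/
theorem no_dicyclic_law_of_two_balanced_32
    (hρρ : ∀ a b, ρ a * ρ b = ρ (a + b)) (hρτ : ∀ a b, ρ a * τ b = τ (b - a))
    (hτρ : ∀ a b, τ a * ρ b = τ (a + b)) (hττ : ∀ a b, τ a * τ b = ρ (c₀ + b - a)) (hc₀ : c₀ ≠ 0)
    (hρ : Function.Injective ρ) (hτ : Function.Injective τ) (hne : ∀ a b, ρ a ≠ τ b)
    (hsurj : ∀ g, (∃ a, ρ a = g) ∨ (∃ a, τ a = g)) (hA : Fintype.card A = 32)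
    (Φ : A →+ ZMod 4 × ZMod 4) (hΦ : Function.Surjective Φ) (hΦc : Φ c₀ = 0)
    (π : A →+ B) (hπ : Function.Surjective π) (hker : ∀ a : A, π a = 0 ↔ a = 0 ∨ a = c₀)
    {m : ℕ} (hB : ∀ b : B, (2 ^ m) • b = 0)
    {S T U : Finset G} (h : TripleProductProperty S T U)
    (hs : (univ.filter fun a : A => ρ a ∈ S).card = (univ.filter fun a : A => τ a ∈ S).card)
    (ht : (univ.filter fun a : A => ρ a ∈ T).card = (univ.filter fun a : A => τ a ∈ T).card) :
    3 * (S.card * T.card * U.card) + 16 ≠ 8 * Fintype.card A := by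
  intro hV
  obtain ⟨s, hs₀⟩ : ∃ s, (univ.filter fun a : A => ρ a ∈ S).card = s := ⟨_, rfl⟩
  obtain ⟨t, ht₀⟩ : ∃ t, (univ.filter fun a : A => ρ a ∈ T).card = t := ⟨_, rfl⟩
  obtain ⟨u₀, hu₀⟩ : ∃ u, (univ.filter fun a : A => ρ a ∈ U).card = u := ⟨_, rfl⟩
  obtain ⟨u₁, hu₁⟩ : ∃ u, (univ.filter fun a : A => τ a ∈ U).card = u := ⟨_, rfl⟩
  have hs₁ : (univ.filter fun a : A => τ a ∈ S).card = s := by rw [← hs, hs₀]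
  have ht₁ : (univ.filter fun a : A => τ a ∈ T).card = t := by rw [← ht, ht₀]
  have cS : S.card = s + s := by rw [card_eq_parts' hρ hτ hne hsurj S, hs₀, hs₁]
  have cT : T.card = t + t := by rw [card_eq_parts' hρ hτ hne hsurj T, ht₀, ht₁]
  have cU : U.card = u₀ + u₁ := by rw [card_eq_parts' hρ hτ hne hsurj U, hu₀, hu₁]
  obtain ⟨h000, h111, -⟩ := vertex_counting' hρρ hρτ hτρ hττ hρ hτ hne h
  rw [hs₀, hs₁, ht₀, ht₁, hu₀, hu₁] at h000 h111
  have hV' := hV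
  rw [cS, cT, cU] at hV'
  -- the unbalance `d` of `U` and the bound `s t d ≤ 4`
  obtain ⟨d, hd, hstd⟩ : ∃ d, (u₀ = u₁ + d ∨ u₁ = u₀ + d) ∧ s * t * d ≤ 4 := by
    rcases le_total u₁ u₀ with hle | hle
    · obtain ⟨d, rfl⟩ := Nat.exists_eq_add_of_le hle
      refine ⟨d, Or.inl rfl, ?_⟩
      have e1 : s * t * (u₁ + d) = s * t * u₁ + s * t * d := by ring
      have e2 : (s + s) * (t + t) * (u₁ + d + u₁) = 8 * (s * t * u₁) + 4 * (s * t * d) := by ring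
      rw [e1] at h000; rw [e2] at hV'; omega
    · obtain ⟨d, rfl⟩ := Nat.exists_eq_add_of_le hle
      refine ⟨d, Or.inr rfl, ?_⟩
      have e1 : s * t * (u₀ + d) = s * t * u₀ + s * t * d := by ring
      have e2 : (s + s) * (t + t) * (u₀ + (u₀ + d)) = 8 * (s * t * u₀) + 4 * (s * t * d) := by ring
      rw [e1] at h111; rw [e2] at hV'; omega
  -- class B
  rcases Nat.eq_zero_or_pos d with rfl | hdpos
  · have hu : (univ.filter fun a : A => ρ a ∈ U).card = (univ.filter fun a : A => τ a ∈ U).card := by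
      rw [hu₀, hu₁]; omega
    exact no_classB_dicyclic_law_32 hρρ hρτ hτρ hττ hc₀ hρ hτ hne hsurj hA Φ hΦ hΦc π hker hB h hs ht hu hV
  have hU : (univ.filter fun a : A => ρ a ∈ U).card ≠ (univ.filter fun a : A => τ a ∈ U).card := by
    rw [hu₀, hu₁]; omega
  have hst : s * t ≤ 4 := le_trans (Nat.le_mul_of_pos_right _ hdpos) hstd
  rcases Nat.eq_zero_or_pos s with rfl | hspos
  · simp at hV'; omega
  rcases Nat.eq_zero_or_pos t with rfl | htpos
  · simp at hV'; omega
  have hs4 : s ≤ 4 := le_trans (Nat.le_mul_of_pos_right _ htpos) hst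
  have ht4 : t ≤ 4 := le_trans (Nat.le_mul_of_pos_left _ hspos) hst
  interval_cases s <;> interval_cases t
  all_goals first
    | omega
    | -- two dominoes
      exact no_dicyclic_law_of_two_domino_32 hρρ hρτ hτρ hττ hc₀ hρ hτ hne hsurj hA Φ hΦ hΦc h hs₀ hs₁ ht₀ ht₁ hV
    | -- class N1, roles `(S, T, U)`
      exact no_n1_dicyclic_law_z4z4 hρρ hρτ hτρ hττ hc₀ hρ hτ hne hsurj Φ hΦ hΦc π hπ hker hB h hs₀ hs₁ ht₀ ht₁ hU
        hV
    | -- class N1, roles `(T, S, U)`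
      exact no_n1_dicyclic_law_z4z4 hρρ hρτ hτρ hττ hc₀ hρ hτ hne hsurj Φ hΦ hΦc π hπ hker hB
        (tpp_reverse h).rotate ht₀ ht₁ hs₀ hs₁ hU
        (by rw [show T.card * S.card * U.card = S.card * T.card * U.card by ring]; exact hV)
    | -- class N3
      exact no_n3_dicyclic_law_32 hρρ hρτ hτρ hττ hc₀ hρ hτ hne hsurj hA Φ hΦ hΦc π hker hB h hs₀ hs₁ ht₀ ht₁ hV
    | -- class N2, roles `(S, U, T)`
      exact no_n2_dicyclic_law_32 hρρ hρτ hτρ hττ hc₀ hρ hτ hne hsurj hA Φ hΦ hΦc π hker hB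
        (tpp_reverse h).rotate.rotate hs₀ hs₁ ht₀ ht₁
        (by rw [show S.card * U.card * T.card = S.card * T.card * U.card by ring]; exact hV)
    | -- class N2, roles `(T, U, S)`
      exact no_n2_dicyclic_law_32 hρρ hρτ hτρ hττ hc₀ hρ hτ hne hsurj hA Φ hΦ hΦc π hker hB
        h.rotate ht₀ ht₁ hs₀ hs₁
        (by rw [show T.card * U.card * S.card = S.card * T.card * U.card by ring]; exact hV)

/-- **The dicyclic law at `|A| = 32` is not attained when `A/⟨c₀⟩ ↠ ℤ₄ × ℤ₄`.**  Dicyclic type `G(A, c₀)` (`c₀ ≠ 0`),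
`|A| = 32`, `Φ : A →+ ZMod 4 × ZMod 4` onto with `Φ c₀ = 0`.  For every TPP triple: `3|S||T||U| + 16 ≠ 8|A|`.
[folklore] -/
theorem no_dicyclic_law_card_32_of_onto_z4z4
    (hρρ : ∀ a b, ρ a * ρ b = ρ (a + b)) (hρτ : ∀ a b, ρ a * τ b = τ (b - a))
    (hτρ : ∀ a b, τ a * ρ b = τ (a + b)) (hττ : ∀ a b, τ a * τ b = ρ (c₀ + b - a)) (hc₀ : c₀ ≠ 0)
    (hρ : Function.Injective ρ) (hτ : Function.Injective τ) (hne : ∀ a b, ρ a ≠ τ b)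
    (hsurj : ∀ g, (∃ a, ρ a = g) ∨ (∃ a, τ a = g)) (hA : Fintype.card A = 32)
    (Φ : A →+ ZMod 4 × ZMod 4) (hΦ : Function.Surjective Φ) (hΦc : Φ c₀ = 0)
    {S T U : Finset G} (h : TripleProductProperty S T U) :
    3 * (S.card * T.card * U.card) + 16 ≠ 8 * Fintype.card A := by
  classical
  intro hV
  -- the `2`-group quotient `B = A/⟨c₀⟩`
  have h2c₀ : c₀ + c₀ = 0 := two_c0_eq_zero hρτ hτρ hττ hτ
  let K : AddSubgroup A := AddSubgroup.zmultiples c₀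
  let π : A →+ A ⧸ K := QuotientAddGroup.mk' K
  have hker : ∀ x : A, π x = 0 ↔ x = 0 ∨ x = c₀ := by
    intro x
    rw [QuotientAddGroup.mk'_apply, QuotientAddGroup.eq_zero_iff]
    exact mem_zmultiples_of_two h2c₀ x
  have hπ : Function.Surjective π := QuotientAddGroup.mk'_surjective K
  have hB : ∀ b : A ⧸ K, (2 ^ 5) • b = 0 := by
    intro b
    obtain ⟨x, rfl⟩ := hπ b
    rw [← map_nsmul, show (2 ^ 5 : ℕ) = Fintype.card A by rw [hA]; norm_num, card_nsmul_eq_zero, map_zero]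
  obtain ⟨h000, h111, h100, h011, h010, h101, h001, h110⟩ := vertex_counting' hρρ hρτ hτρ hττ hρ hτ hne h
  have hV' := hV
  rw [card_eq_parts' hρ hτ hne hsurj S, card_eq_parts' hρ hτ hne hsurj T, card_eq_parts' hρ hτ hne hsurj U] at hV'
  rcases two_balanced_of_vertex_bounds16 _ _ _ _ _ _ _ h000 h111 h100 h011 h010 h101 h001 h110 (by omega)
      (by omega) with ⟨hs, ht⟩ | ⟨hs, hu⟩ | ⟨ht, hu⟩
  · exact no_dicyclic_law_of_two_balanced_32 hρρ hρτ hτρ hττ hc₀ hρ hτ hne hsurj hA Φ hΦ hΦc π hπ hker hB h hs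
      ht hV
  · have := no_dicyclic_law_of_two_balanced_32 hρρ hρτ hτρ hττ hc₀ hρ hτ hne hsurj hA Φ hΦ hΦc π hπ hker hB
      h.rotate.rotate hu hs
    exact this (by rw [show U.card * S.card * T.card = S.card * T.card * U.card by ring]; exact hV)
  · have := no_dicyclic_law_of_two_balanced_32 hρρ hρτ hτρ hττ hc₀ hρ hτ hne hsurj hA Φ hΦ hΦc π hπ hker hB
      h.rotate ht hu
    exact this (by rw [show T.card * U.card * S.card = S.card * T.card * U.card by ring]; exact hV)

end Assembly

/-! ## Instances at `|A| = 32` with `A/⟨c₀⟩ ≅ ℤ₄²` (census rows NR117, NR118) -/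

section Instances

/-- **`G(ℤ₄ × ℤ₈, (0,4))` (`A/⟨c₀⟩ ≅ ℤ₄²`, order `64`, census row NR117): the dicyclic law `3V + 16 = 8·32` (`V = 80`) is
not attained.** [folklore] -/
theorem z4_z8_dicyclic_no_law_0_4 [Fact (((0, 4) : ZMod 4 × ZMod 8) + (0, 4) = 0)]
    (S T U : Finset (DihedralLikeGroup (ZMod 4 × ZMod 8) (0, 4)))
    (h : Literature.Combinatorics.Additive.TripleProductProperty S T U) :
    3 * (S.card * T.card * U.card) + 16 ≠ 8 * Fintype.card (ZMod 4 × ZMod 8) := by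
  refine no_dicyclic_law_card_32_of_onto_z4z4 (A := ZMod 4 × ZMod 8) (c₀ := (0, 4))
    DihedralLikeGroup.rho_mul_rho DihedralLikeGroup.rho_mul_tau DihedralLikeGroup.tau_mul_rho
    DihedralLikeGroup.tau_mul_tau (by decide) DihedralLikeGroup.rho_injective DihedralLikeGroup.tau_injective
    DihedralLikeGroup.rho_ne_tau DihedralLikeGroup.rho_or_tau (by simp)
    ((AddMonoidHom.id (ZMod 4)).prodMap (ZMod.castHom (show 4 ∣ 8 by norm_num) (ZMod 4)).toAddMonoidHom) ?_
    (by decide) h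
  intro q
  obtain ⟨b, hb⟩ := ZMod.castHom_surjective (show 4 ∣ 8 by norm_num) (n := 8) q.2
  exact ⟨(q.1, b), Prod.ext rfl hb⟩

/-- **`G(ℤ₂ × ℤ₄ × ℤ₄, (1,0,0))` (`A/⟨c₀⟩ ≅ ℤ₄²`, order `64`, census row NR118): the dicyclic law is not attained.**
[folklore] -/
theorem z2_z4_z4_dicyclic_no_law_1_0_0 [Fact (((1, 0, 0) : ZMod 2 × ZMod 4 × ZMod 4) + (1, 0, 0) = 0)]
    (S T U : Finset (DihedralLikeGroup (ZMod 2 × ZMod 4 × ZMod 4) (1, 0, 0)))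
    (h : Literature.Combinatorics.Additive.TripleProductProperty S T U) :
    3 * (S.card * T.card * U.card) + 16 ≠ 8 * Fintype.card (ZMod 2 × ZMod 4 × ZMod 4) := by
  refine no_dicyclic_law_card_32_of_onto_z4z4 (A := ZMod 2 × ZMod 4 × ZMod 4) (c₀ := (1, 0, 0))
    DihedralLikeGroup.rho_mul_rho DihedralLikeGroup.rho_mul_tau DihedralLikeGroup.tau_mul_rho
    DihedralLikeGroup.tau_mul_tau (by decide) DihedralLikeGroup.rho_injective DihedralLikeGroup.tau_injective
    DihedralLikeGroup.rho_ne_tau DihedralLikeGroup.rho_or_tau (by simp)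
    (AddMonoidHom.snd (ZMod 2) (ZMod 4 × ZMod 4)) ?_ (by decide) h
  intro q
  exact ⟨(0, q), rfl⟩

end Instances

end Summit.MatrixMultiplication.OmegaCensus
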